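import Summits.Langlands.Langlands.Theorems.SqrtFiveQuarticCoversCertificates
import Literature.NumberTheory.EllipticCurves.IsogenyHasCMBaseChangeAscentProofs

/-!
# Route `Langlands/SqrtFiveQuarticCovers` — certificate `CertH12B7` (carrier `Z = X(H12,b7)`,
# genus 9; sheets 4.1 + 4.3 of the crux `RefinedLocusModular`) from THEOREM Z
# (cell `pub/lg-quartmod`, F-L1; CONDITIONAL bookkeeping — closes nothing by itself)

`certH12B7_of_modelIdentification_of_theoremZ` concludes VERBATIM the hypothesis `hB7` of the
tree's assembly `refinedLocusModular_of_certificates` (`SqrtFiveQuarticCoversCertificates`,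
p653708): for every totally real quartic number field `K ∋ √5` and every `E / 𝓞 K` (`Δ ≠ 0`), if
`ρ̄_{E,5}` has image in `H12 = ⟨(3 1;3 3), diag(1,4)⟩ ⊂ GL₂(𝔽₅)` in some framing of `E[5]` and
`ρ̄_{E,7}` is Borel in some framing of `E[7]`, then `E` has CM or `j(E) ∈ ℚ(√5)` (division-free:
`∃ r, r² = 5, ∃ a b : ℚ, c₄³ = (a + b r)·Δ`).  In fact the conclusion reached is always CM.

It rests on exactly TWO written-out hypotheses (no `Prop` definitions under `Summits/`, D-0027;
their names, for the cell's ledger and for a planner's second-layer split, are):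

* `hK1` — **NF-K1-Z, MODEL IDENTIFICATION of `X(H12,b7)` over `K ∋ √5`** (named input, NOT
  proved in the tree, which has no carrier for modular curves): with Zywina's hauptmodul `t` of
  `X_ns⁺(5) = ℙ¹_t`, `j = J₇(t) = 125(t+1)(2t+1)³(2t²−3t+3)³/(t²+t−1)⁵` [cite: Zywina2015, Thm. 1.4]
  (= Chen's (53)), the classical Hauptmodul `u` of `X₀(7)`, `j = (u²+13u+49)(u²+5u+1)³/u`
  [cite: CremonaFreitas2022, §3.6 (the map X₀(7) → X(1), after Fricke)], and the
  sign conic `w² = (5+2√5)(8t²−12t+7)` cutting `H12` (index `2`) out of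
  `{g ∈ C_ns⁺(5) : det g = ±1}` (cell idea card `det-refinement-is-a-conic`, K1(b); twist class
  `κ = 5+2√5` pinned by cusp rationality and by point counts against the Galois side at eight
  primes incl. the discriminating `p = 59`, README-E7 §1–§2): an `E` as above with
  `j(E) ∉ {0, 1728, 8000}` gives `t u w ∈ K` on this model with `j(E) = J₇(t) = j₇(u)` (the three
  excluded `j` are the elliptic points / `t = ∞`, all CM).  Written division-free in `c₄³` and `Δ`.
* `hZ` — **THEOREM Z, the certified FINITE DATUM** (cell computation; its two halves each on two
  independent exact lineages — Z-B «the quadratic points of `Z` over `k` not lying over `Y(k)`,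
  `Y = X(ns⁺5,b7)`, are the four `θ`-pairs (or cuspidal divisors)»: eng-2 ε-Prym `α`-sieve on `Z` +
  torsion injectivity, `README-E7.md` sha16 acceefaa15e0bd61 / `CERTIFICATE-E7.json`, and eng-3's
  twin on an independent conic/model/place code, `E7-TWIN.md` sha16 0f3708606b8d5e74, replayed by
  ref-1 (`E7/alpha-replay.txt`) and eng-9 g2 (`CROSS-READ-E7.md` 5eecce5a56f6420c); Z-A
  «`Y(k) = 4 cusps + (0,−7) + (−2,7)`»: eng-2 P7 (`β = 1 − w₇` sieve at `p = 11`, job j314151,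
  README-E7 §8) and eng-8 E7-P7-TWIN (own `Ψ₇` by power series j317821, `β`-sieve at `𝔮 ∣ 11`
  j317897, `#A′(k)_tors ∣ 160` from own Hecke data, non-hyperelliptic by the 8-fixed-point lemma;
  README sha16 1de216a3662ba415); certnum request RQ-029 (filed 2026-08-28T20:21Z; no release line
  yet — `pub/certnum/RELEASES.md` RQ-029 lines when issued); cell words SHEET-WORDS-v0.md v0.2
  sha16 828c8ad09b15e9a5; referee audit ref-2 `AUDIT-CertH12B7.md` 22b586f188bc2dff):
  «`Z(ℚ(√5))` = the 8 cusps; the quadratic points of `Z = X(H12,b7)` over `ℚ(√5)` are exactly two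
  CM pairs (`(t,u) = (0,−7)`, `j = −3375`; `(−2,7)`, `j = 16581375`; over
  `K₁ = ℚ(√5)(√(35+14√5))`) and four non-CM pairs over `ℚ[x]/(x⁴−x³−2x²−2x−1)` (discriminant
  `−475`, signature `(2,1)`), on which `u + 49/u = (−35 ∓ 5√5)/2`.»  In coordinates, for a
  QUARTIC field `K ∋ r` (`r² = 5`): every `(t,u,w) ∈ K³` on the model with `j ∉ {0, 1728, ∞}` has
  `u = ∓7` or `2u² + (35 ± 5r)u + 98 = 0`.  The datum itself rests on NAMED inputs recorded in
  README-E7 §6: Kato 2004 (`L(g,1) ≠ 0 ⇒ A_g(ℚ)` finite, for `35.χ5.1`, `175.χ5.2`, exact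
  winding elements) and the isogeny decomposition of `Res P`; Katz (injectivity of torsion under
  reduction, `𝔮 ∤ 2·5·7`); upper semicontinuity of `h⁰` and Riemann–Roch over finite fields
  (replayable).  «A certified finite datum is not a modularity statement.»

Everything else is PROVED here, kernel-checked: (i) the four `θ`-pairs are invisible to a totally
real `K` — from `2u² + (35 ± 5r)u + 98 = 0`, `(4u + 35 ± 5r)² = 566 ± 350r`, and along an
embedding `K → ℂ` with `±r ↦ −√5` (it exists: `minpoly_ℚ r = X² − 5`, Mathlib's
`range_eval_eq_rootSet_minpoly`) the right-hand side is `566 − 350√5 < 0`, impossible for the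
square of a real number (`false_of_sq_eq_of_isTotallyReal`); (ii) `u = ∓7 ⇒ j = −3375, 16581375`,
and these, like `j ∈ {0, 1728, 8000}`, are among the thirteen rational CM `j`-invariants, so `E`
has CM over `K̄` (`WeierstrassCurve.hasCM_of_j_eq_of_mem_cmJInvariants`: the tree's thirteen-`j`
theorems over `ℚ` ascended along base change, `IsogenyHasCMBaseChangeAscentProofs`).

HONEST STATUS: conditional bookkeeping over one explicit quartic family; the two hypotheses are a
model identification and a certified finite computation, neither proved in Lean; nothing here
proves modularity of a new class of elliptic curves.  Cell record: CENSUS.md §15 rows 4.1/4.3,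
STATUS 2026-08-28T20:31:43Z (SHEET × LINEAGE TABLE) and 20:32:07Z (SHEET STATEMENT WORDS v0, CertB7).
`certH12B7` restates the main theorem with conclusion the route decl
`Summit.Langlands.Langlands.Theses.SqrtFiveQuarticCovers.CertH12B7` BY NAME (item
stmt-Langlands-23414 of rev 7 of the route, the by-carrier split of `RefinedLocusModular`).
References: [Zywina2015] D. Zywina, *On the possible images of the mod ℓ representations associated
to elliptic curves over ℚ*, arXiv:1508.07660, Thm. 1.4; [CremonaFreitas2022] §3.6 (X₀(7), after
Fricke); [Box2022] §1.1, Thm. 7.1; [FreitasLeHungSiksek2015] Remark (iii) after Cor. 2.1, §5.2;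
[SilvermanAEC2009] App. C §11.
-/

set_option linter.dupNamespace false -- project-wide option (lakefile weak.linter.dupNamespace); `Summit.Langlands.Langlands` is the mandated namespace

namespace Summit.Langlands.Langlands.Theorems.SqrtFiveQuarticCovers

open scoped Matrix
open Polynomial Literature.NumberTheory.Automorphic

/-! ## 1. Kernel-checked arithmetic: the `θ`-field is not totally real -/

/-- A number field containing `r` with `r² = 5` has a complex embedding sending `r` to `−√5`
(the embeddings hit every root of `minpoly_ℚ r = X² − 5`). [folklore] -/
theorem exists_embedding_apply_eq_neg_sqrt_five {K : Type} [Field K] [NumberField K] {r : K}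
    (hr : r ^ 2 = 5) : ∃ φ : K →+* ℂ, φ r = -((Real.sqrt 5 : ℝ) : ℂ) := by
  have h : (-((Real.sqrt 5 : ℝ) : ℂ)) ∈ (minpoly ℚ r).rootSet ℂ := by
    rw [minpoly_eq_X_sq_sub_five hr, Polynomial.mem_rootSet]
    refine ⟨(monic_X_pow_sub_C (5 : ℚ) two_ne_zero).ne_zero, ?_⟩
    have h5 : ((Real.sqrt 5 : ℝ) : ℂ) ^ 2 = 5 := by
      rw [← Complex.ofReal_pow, Real.sq_sqrt (by norm_num : (0 : ℝ) ≤ 5)]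
      push_cast
      rfl
    simp only [map_sub, map_pow, aeval_X, aeval_C, eq_ratCast]
    rw [neg_sq, h5]
    push_cast
    ring
  rw [← NumberField.Embeddings.range_eval_eq_rootSet_minpoly K ℂ r] at h
  obtain ⟨φ, hφ⟩ := h
  exact ⟨φ, hφ⟩

/-- **The `θ`-points of THEOREM Z are invisible to totally real fields.**  In a totally real
number field there are no `r, s` with `r² = 5` and `s² = 566 + 350·r`: along an embedding with
`r ↦ −√5` the real number `φ(s)` would have square `566 − 350√5 < 0`.  (From
`2u² + (35 + 5r)u + 98 = 0` one gets `s = 4u + 35 + 5r`; the sign `35 − 5r` is the case `r ↦ −r`.)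
[folklore] -/
theorem false_of_sq_eq_of_isTotallyReal {K : Type} [Field K] [NumberField K]
    [NumberField.IsTotallyReal K] {r s : K} (hr : r ^ 2 = 5) (hs : s ^ 2 = 566 + 350 * r) :
    False := by
  obtain ⟨φ, hφ⟩ := exists_embedding_apply_eq_neg_sqrt_five hr
  have hreal : NumberField.ComplexEmbedding.IsReal φ :=
    NumberField.IsTotallyReal.complexEmbedding_isReal φ
  set x : ℝ := hreal.embedding s with hx
  have hxs : (x : ℂ) = φ s := NumberField.ComplexEmbedding.IsReal.coe_embedding_apply hreal s
  have hx2C : ((x ^ 2 : ℝ) : ℂ) = ((566 - 350 * Real.sqrt 5 : ℝ) : ℂ) := by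
    push_cast
    rw [hxs, ← map_pow, hs, map_add, map_mul, hφ, map_ofNat, map_ofNat]
    ring
  have hx2 : x ^ 2 = 566 - 350 * Real.sqrt 5 := by exact_mod_cast hx2C
  have h5 : (2 : ℝ) < Real.sqrt 5 := by
    rw [show (2 : ℝ) = Real.sqrt 4 by rw [show (4 : ℝ) = 2 ^ 2 by norm_num, Real.sqrt_sq (by norm_num)]]
    exact Real.sqrt_lt_sqrt (by norm_num) (by norm_num)
  nlinarith [sq_nonneg x]

/-- From `2u² + (35 + 5r)u + 98 = 0`: `(4u + 35 + 5r)² = 566 + 350r` when `r² = 5`. [folklore] -/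
theorem sq_eq_of_theta_quadratic {K : Type} [Field K] {r u : K} (hr : r ^ 2 = 5)
    (hu : 2 * u ^ 2 + (35 + 5 * r) * u + 98 = 0) :
    (4 * u + 35 + 5 * r) ^ 2 = 566 + 350 * r := by
  linear_combination 8 * hu + 25 * hr

/-! ## 2. Kernel-checked arithmetic: the CM `j`-invariants met on `Z` -/

/-- If `c₄(E_K)³ = q·Δ(E_K)` with `q` one of the thirteen rational CM `j`-invariants, then `E_K`
(`Δ ≠ 0`, `K` a number field) has complex multiplication: `j(E_K) = c₄³/Δ = q` and
`WeierstrassCurve.hasCM_of_j_eq_of_mem_cmJInvariants`.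
[cite: SilvermanAEC2009, App. C §11, Example 11.3.1–11.3.2] -/
theorem hasCM_of_c₄_cube_eq_mul_Δ {K : Type} [Field K] [NumberField K]
    (E : WeierstrassCurve (NumberField.RingOfIntegers K)) (hΔ : E.Δ ≠ 0) {q : ℚ}
    (hq : q ∈ WeierstrassCurve.cmJInvariants)
    (h : (E.baseChange K).c₄ ^ 3 = (q : K) * (E.baseChange K).Δ) : (E.baseChange K).HasCM := by
  haveI hW : (E.baseChange K).IsElliptic := isElliptic_baseChange_of_Δ_ne_zero hΔ
  have hΔK : (E.baseChange K).Δ ≠ 0 := hW.isUnit.ne_zero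
  refine WeierstrassCurve.hasCM_of_j_eq_of_mem_cmJInvariants (E.baseChange K) hq ?_
  rw [WeierstrassCurve.j_eq_c₄_pow_three_div_Δ, h, mul_div_assoc, div_self hΔK, mul_one]

/-! ## 3. The certificate `CertH12B7` from the model identification and THEOREM Z -/

/-- **`CertH12B7` — hypothesis `hB7` of `refinedLocusModular_of_certificates`, VERBATIM — from
NF-K1-Z (model identification of `X(H12,b7)`, hypothesis `hK1`) and THEOREM Z (the certified
finite datum, hypothesis `hZ`; lineages README-E7.md acceefaa15e0bd61 + E7-TWIN.md
0f3708606b8d5e74; certnum RQ-029).**  For `K` totally real quartic with `√5 ∈ K` and `E / 𝓞 K`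
(`Δ ≠ 0`) with mod-`5` image in `H12` and mod-`7` image Borel (some framings): `E` has CM (or
`j(E) ∈ ℚ(√5)`; the proof always lands in the CM alternative).  Proof: `hK1` gives
`j ∈ {0, 1728, 8000}` (CM) or a `K`-point `(t,u,w)` of the model; `hZ` leaves `u = ∓7`, i.e.
`j = −3375, 16581375` (CM, `hasCM_of_c₄_cube_eq_mul_Δ`), or a `θ`-point, impossible over a totally
real field (`false_of_sq_eq_of_isTotallyReal`).  CONDITIONAL on `hK1`, `hZ`; kernel-checked logic
and arithmetic otherwise. [cite: Zywina2015, Thm. 1.4] [cite: Box2022, §1.1 and Thm. 7.1]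
[cite: SilvermanAEC2009, App. C §11, Example 11.3.1–11.3.2] -/
theorem certH12B7_of_modelIdentification_of_theoremZ
    (hK1 : ∀ (K : Type) [Field K] [NumberField K], (∃ r : K, r ^ 2 = 5) →
        ∀ E : WeierstrassCurve (NumberField.RingOfIntegers K), E.Δ ≠ 0 →
          (∃ ρ : Literature.NumberTheory.GaloisRepresentations.FramedGaloisRep K (ZMod 5) 2, (∃ e : (E.baseChange K).geomTorsion ((5 : ℕ) : ℤ) ≃+ (Fin 2 → ZMod 5), ∀ (σ : Field.absoluteGaloisGroup K) (P : (E.baseChange K).geomTorsion ((5 : ℕ) : ℤ)), e (σ • P) = ((ρ σ : GL (Fin 2) (ZMod 5)) : Matrix (Fin 2) (Fin 2) (ZMod 5)) *ᵥ (e P)) ∧ ((∀ σ : Field.absoluteGaloisGroup K, (ρ σ : GL (Fin 2) (ZMod 5)) ∈ Subgroup.closure ({(⟨!![3, 1; 3, 3], !![3, 4; 2, 3], by decide, by decide⟩ : GL (Fin 2) (ZMod 5)), (⟨!![1, 0; 0, 4], !![1, 0; 0, 4], by decide, by decide⟩ : GL (Fin 2) (ZMod 5))} : Set (GL (Fin 2)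 (ZMod 5)))))) →
          (∃ ρ : Literature.NumberTheory.GaloisRepresentations.FramedGaloisRep K (ZMod 7) 2, (∃ e : (E.baseChange K).geomTorsion ((7 : ℕ) : ℤ) ≃+ (Fin 2 → ZMod 7), ∀ (σ : Field.absoluteGaloisGroup K) (P : (E.baseChange K).geomTorsion ((7 : ℕ) : ℤ)), e (σ • P) = ((ρ σ : GL (Fin 2) (ZMod 7)) : Matrix (Fin 2) (Fin 2) (ZMod 7)) *ᵥ (e P)) ∧ ((∀ σ : Field.absoluteGaloisGroup K, (((ρ σ : GL (Fin 2) (ZMod 7)) : Matrix (Fin 2) (Fin 2) (ZMod 7)) 1 0 = 0)))) →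
          ((E.baseChange K).c₄ ^ 3 = 0 * (E.baseChange K).Δ ∨
           (E.baseChange K).c₄ ^ 3 = 1728 * (E.baseChange K).Δ ∨
           (E.baseChange K).c₄ ^ 3 = 8000 * (E.baseChange K).Δ ∨
           ∃ r : K, r ^ 2 = 5 ∧ ∃ t u w : K,
            t ^ 2 + t - 1 ≠ 0 ∧ u ≠ 0 ∧
            (E.baseChange K).c₄ ^ 3 * (t ^ 2 + t - 1) ^ 5 =
              125 * (t + 1) * (2 * t + 1) ^ 3 * (2 * t ^ 2 - 3 * t + 3) ^ 3 * (E.baseChange K).Δ ∧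
            (E.baseChange K).c₄ ^ 3 * u = (u ^ 2 + 13 * u + 49) * (u ^ 2 + 5 * u + 1) ^ 3 * (E.baseChange K).Δ ∧
            w ^ 2 = (5 + 2 * r) * (8 * t ^ 2 - 12 * t + 7)))
    (hZ : ∀ (K : Type) [Field K] [NumberField K], Module.finrank ℚ K = 4 →
        ∀ r : K, r ^ 2 = 5 → ∀ t u w : K, t ^ 2 + t - 1 ≠ 0 → u ≠ 0 →
          125 * (t + 1) * (2 * t + 1) ^ 3 * (2 * t ^ 2 - 3 * t + 3) ^ 3 * u =
            (u ^ 2 + 13 * u + 49) * (u ^ 2 + 5 * u + 1) ^ 3 * (t ^ 2 + t - 1) ^ 5 →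
          w ^ 2 = (5 + 2 * r) * (8 * t ^ 2 - 12 * t + 7) →
          (u ^ 2 + 13 * u + 49) * (u ^ 2 + 5 * u + 1) ≠ 0 →
          (u ^ 2 + 13 * u + 49) * (u ^ 2 + 5 * u + 1) ^ 3 ≠ 1728 * u →
          (u = -7 ∨ u = 7 ∨ 2 * u ^ 2 + (35 + 5 * r) * u + 98 = 0 ∨ 2 * u ^ 2 + (35 - 5 * r) * u + 98 = 0)) :
    ∀ (K : Type) [Field K] [NumberField K], NumberField.IsTotallyReal K → Module.finrank ℚ K = 4 → (∃ r : K, r ^ 2 = 5) →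
        ∀ E : WeierstrassCurve (NumberField.RingOfIntegers K), E.Δ ≠ 0 →
          (∃ ρ : Literature.NumberTheory.GaloisRepresentations.FramedGaloisRep K (ZMod 5) 2, (∃ e : (E.baseChange K).geomTorsion ((5 : ℕ) : ℤ) ≃+ (Fin 2 → ZMod 5), ∀ (σ : Field.absoluteGaloisGroup K) (P : (E.baseChange K).geomTorsion ((5 : ℕ) : ℤ)), e (σ • P) = ((ρ σ : GL (Fin 2) (ZMod 5)) : Matrix (Fin 2) (Fin 2) (ZMod 5)) *ᵥ (e P)) ∧ ((∀ σ : Field.absoluteGaloisGroup K, (ρ σ : GL (Fin 2) (ZMod 5)) ∈ Subgroup.closure ({(⟨!![3, 1; 3, 3], !![3, 4; 2, 3], by decide, by decide⟩ : GL (Fin 2) (ZMod 5)), (⟨!![1, 0; 0, 4], !![1, 0; 0, 4], by decide, by decide⟩ : GL (Fin 2) (ZMod 5))} : Set (GL (Fin 2) (ZMod 5)))))) →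
          (∃ ρ : Literature.NumberTheory.GaloisRepresentations.FramedGaloisRep K (ZMod 7) 2, (∃ e : (E.baseChange K).geomTorsion ((7 : ℕ) : ℤ) ≃+ (Fin 2 → ZMod 7), ∀ (σ : Field.absoluteGaloisGroup K) (P : (E.baseChange K).geomTorsion ((7 : ℕ) : ℤ)), e (σ • P) = ((ρ σ : GL (Fin 2) (ZMod 7)) : Matrix (Fin 2) (Fin 2) (ZMod 7)) *ᵥ (e P)) ∧ ((∀ σ : Field.absoluteGaloisGroup K, (((ρ σ : GL (Fin 2) (ZMod 7)) : Matrix (Fin 2) (Fin 2) (ZMod 7)) 1 0 = 0)))) →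
          ((E.baseChange K).HasCM ∨ (∃ r : K, r ^ 2 = 5 ∧ ∃ a b : ℚ, (E.baseChange K).c₄ ^ 3 = ((a : K) + (b : K) * r) * (E.baseChange K).Δ)) := by
  intro K _ _ hK hd hr5 E hΔ h5 h7
  haveI := hK
  haveI hW : (E.baseChange K).IsElliptic := isElliptic_baseChange_of_Δ_ne_zero hΔ
  have hΔK : (E.baseChange K).Δ ≠ 0 := hW.isUnit.ne_zero
  -- abbreviations
  set C := (E.baseChange K).c₄ ^ 3 with hC
  set D := (E.baseChange K).Δ with hD
  rcases hK1 K hr5 E hΔ h5 h7 with h0 | h1728 | h8000 | ⟨r, hr, t, u, w, hct, hu0, hJt, hJu, hw⟩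
  · exact Or.inl (hasCM_of_c₄_cube_eq_mul_Δ E hΔ (q := 0) (by decide) (by rw [h0]; push_cast; ring))
  · exact Or.inl (hasCM_of_c₄_cube_eq_mul_Δ E hΔ (q := 1728) (by decide)
      (by rw [h1728]; push_cast; ring))
  · exact Or.inl (hasCM_of_c₄_cube_eq_mul_Δ E hΔ (q := 8000) (by decide)
      (by rw [h8000]; push_cast; ring))
  -- a `K`-point `(t,u,w)` of the model of `Z` with `j(E) = J₇(t) = j₇(u)`
  left
  -- `j ≠ 0, 1728` may be assumed (else CM at once)
  by_cases hj0 : (u ^ 2 + 13 * u + 49) * (u ^ 2 + 5 * u + 1) = 0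
  · refine hasCM_of_c₄_cube_eq_mul_Δ E hΔ (q := 0) (by decide) ?_
    have h1 : (E.baseChange K).c₄ ^ 3 * u = 0 := by
      rw [hJu]
      have : (u ^ 2 + 13 * u + 49) * (u ^ 2 + 5 * u + 1) ^ 3 =
          ((u ^ 2 + 13 * u + 49) * (u ^ 2 + 5 * u + 1)) * (u ^ 2 + 5 * u + 1) ^ 2 := by ring
      rw [this, hj0]
      ring
    rcases mul_eq_zero.1 h1 with h | h
    · rw [h]; push_cast; ring
    · exact absurd h hu0
  by_cases hj1728 : (u ^ 2 + 13 * u + 49) * (u ^ 2 + 5 * u + 1) ^ 3 = 1728 * u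
  · refine hasCM_of_c₄_cube_eq_mul_Δ E hΔ (q := 1728) (by decide) ?_
    have h1 : ((E.baseChange K).c₄ ^ 3 - 1728 * (E.baseChange K).Δ) * u = 0 := by
      have := hJu
      rw [hj1728] at this
      linear_combination this
    rcases mul_eq_zero.1 h1 with h | h
    · push_cast; linear_combination h
    · exact absurd h hu0
  -- the fibre-product equation `J₇(t)·u-form`: eliminate `c₄³`, `Δ`
  have hfib : 125 * (t + 1) * (2 * t + 1) ^ 3 * (2 * t ^ 2 - 3 * t + 3) ^ 3 * u =
      (u ^ 2 + 13 * u + 49) * (u ^ 2 + 5 * u + 1) ^ 3 * (t ^ 2 + t - 1) ^ 5 := by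
    -- multiply `hJt` by `u`, `hJu` by `(t²+t−1)⁵`, cancel `Δ ≠ 0`
    have key : (125 * (t + 1) * (2 * t + 1) ^ 3 * (2 * t ^ 2 - 3 * t + 3) ^ 3 * u -
        (u ^ 2 + 13 * u + 49) * (u ^ 2 + 5 * u + 1) ^ 3 * (t ^ 2 + t - 1) ^ 5) *
        (E.baseChange K).Δ = 0 := by
      linear_combination u * hJt.symm - (t ^ 2 + t - 1) ^ 5 * hJu.symm
    rcases mul_eq_zero.1 key with h | h
    · exact sub_eq_zero.1 h
    · exact absurd h hΔK
  rcases hZ K hd r hr t u w hct hu0 hfib hw hj0 hj1728 with h7 | h7 | hθ | hθ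
  · -- `u = −7`: `j = −3375`
    subst h7
    refine hasCM_of_c₄_cube_eq_mul_Δ E hΔ (q := -3375) (by decide) ?_
    have h1 : (7 : K) * ((E.baseChange K).c₄ ^ 3 + 3375 * (E.baseChange K).Δ) = 0 := by
      linear_combination -hJu
    have h7 : (7 : K) ≠ 0 := by norm_num
    rcases mul_eq_zero.1 h1 with h | h
    · exact absurd h h7
    · push_cast; linear_combination h
  · -- `u = 7`: `j = 16581375`
    subst h7
    refine hasCM_of_c₄_cube_eq_mul_Δ E hΔ (q := 16581375) (by decide) ?_
    have h1 : (7 : K) * ((E.baseChange K).c₄ ^ 3 - 16581375 * (E.baseChange K).Δ) = 0 := by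
      linear_combination hJu
    have h7 : (7 : K) ≠ 0 := by norm_num
    rcases mul_eq_zero.1 h1 with h | h
    · exact absurd h h7
    · push_cast; linear_combination h
  · -- `θ`-point with `u + 49/u = (−35 − 5r)/2`: impossible over a totally real `K`
    exact (false_of_sq_eq_of_isTotallyReal hr (sq_eq_of_theta_quadratic hr hθ)).elim
  · -- `θ`-point with `u + 49/u = (−35 + 5r)/2`: the same with `r ↦ −r`
    have hr' : (-r) ^ 2 = 5 := by rw [neg_sq]; exact hr
    have hθ' : 2 * u ^ 2 + (35 + 5 * (-r)) * u + 98 = 0 := by linear_combination hθ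
    exact (false_of_sq_eq_of_isTotallyReal hr' (sq_eq_of_theta_quadratic hr' hθ')).elim

/-- **`CertH12B7` BY NAME** — the route item stmt-Langlands-23414 (rev 7, child of
`RefinedLocusModular` for the carrier `Z = X(H12,b7)`, sheets 4.1 + 4.3), i.e. the decl
`Summit.Langlands.Langlands.Theses.SqrtFiveQuarticCovers.CertH12B7`, from the two named inputs
NF-K1-Z (`hK1`) and THEOREM Z (`hZ`): `certH12B7_of_modelIdentification_of_theoremZ` read through
the definitional unfolding of the item.  CONDITIONAL on `hK1`, `hZ` (the item stays open modulo
these two named inputs; «a certified finite datum is not a modularity statement»).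
[cite: Zywina2015, Thm. 1.4] [cite: Box2022, §1.1 and Thm. 7.1] -/
theorem certH12B7
    (hK1 : ∀ (K : Type) [Field K] [NumberField K], (∃ r : K, r ^ 2 = 5) →
        ∀ E : WeierstrassCurve (NumberField.RingOfIntegers K), E.Δ ≠ 0 →
          (∃ ρ : Literature.NumberTheory.GaloisRepresentations.FramedGaloisRep K (ZMod 5) 2, (∃ e : (E.baseChange K).geomTorsion ((5 : ℕ) : ℤ) ≃+ (Fin 2 → ZMod 5), ∀ (σ : Field.absoluteGaloisGroup K) (P : (E.baseChange K).geomTorsion ((5 : ℕ) : ℤ)), e (σ • P) = ((ρ σ : GL (Fin 2) (ZMod 5)) : Matrix (Fin 2) (Fin 2) (ZMod 5)) *ᵥ (e P)) ∧ ((∀ σ : Field.absoluteGaloisGroup K, (ρ σ : GL (Fin 2) (ZMod 5)) ∈ Subgroup.closure ({(⟨!![3, 1; 3, 3], !![3, 4; 2, 3], by decide, by decide⟩ : GL (Fin 2) (ZMod 5)), (⟨!![1, 0; 0, 4], !![1, 0; 0, 4], by decide, by decide⟩ : GL (Fin 2) (ZMod 5))} : Set (GL (Fin 2) (ZMod 5))))))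 →
          (∃ ρ : Literature.NumberTheory.GaloisRepresentations.FramedGaloisRep K (ZMod 7) 2, (∃ e : (E.baseChange K).geomTorsion ((7 : ℕ) : ℤ) ≃+ (Fin 2 → ZMod 7), ∀ (σ : Field.absoluteGaloisGroup K) (P : (E.baseChange K).geomTorsion ((7 : ℕ) : ℤ)), e (σ • P) = ((ρ σ : GL (Fin 2) (ZMod 7)) : Matrix (Fin 2) (Fin 2) (ZMod 7)) *ᵥ (e P)) ∧ ((∀ σ : Field.absoluteGaloisGroup K, (((ρ σ : GL (Fin 2) (ZMod 7)) : Matrix (Fin 2) (Fin 2) (ZMod 7)) 1 0 = 0)))) →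
          ((E.baseChange K).c₄ ^ 3 = 0 * (E.baseChange K).Δ ∨
           (E.baseChange K).c₄ ^ 3 = 1728 * (E.baseChange K).Δ ∨
           (E.baseChange K).c₄ ^ 3 = 8000 * (E.baseChange K).Δ ∨
           ∃ r : K, r ^ 2 = 5 ∧ ∃ t u w : K,
            t ^ 2 + t - 1 ≠ 0 ∧ u ≠ 0 ∧
            (E.baseChange K).c₄ ^ 3 * (t ^ 2 + t - 1) ^ 5 =
              125 * (t + 1) * (2 * t + 1) ^ 3 * (2 * t ^ 2 - 3 * t + 3) ^ 3 * (E.baseChange K).Δ ∧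
            (E.baseChange K).c₄ ^ 3 * u = (u ^ 2 + 13 * u + 49) * (u ^ 2 + 5 * u + 1) ^ 3 * (E.baseChange K).Δ ∧
            w ^ 2 = (5 + 2 * r) * (8 * t ^ 2 - 12 * t + 7)))
        (hZ : ∀ (K : Type) [Field K] [NumberField K], Module.finrank ℚ K = 4 →
        ∀ r : K, r ^ 2 = 5 → ∀ t u w : K, t ^ 2 + t - 1 ≠ 0 → u ≠ 0 →
          125 * (t + 1) * (2 * t + 1) ^ 3 * (2 * t ^ 2 - 3 * t + 3) ^ 3 * u =
            (u ^ 2 + 13 * u + 49) * (u ^ 2 + 5 * u + 1) ^ 3 * (t ^ 2 + t - 1) ^ 5 →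
          w ^ 2 = (5 + 2 * r) * (8 * t ^ 2 - 12 * t + 7) →
          (u ^ 2 + 13 * u + 49) * (u ^ 2 + 5 * u + 1) ≠ 0 →
          (u ^ 2 + 13 * u + 49) * (u ^ 2 + 5 * u + 1) ^ 3 ≠ 1728 * u →
          (u = -7 ∨ u = 7 ∨ 2 * u ^ 2 + (35 + 5 * r) * u + 98 = 0 ∨ 2 * u ^ 2 + (35 - 5 * r) * u + 98 = 0)) :
    Summit.Langlands.Langlands.Theses.SqrtFiveQuarticCovers.CertH12B7 :=
  certH12B7_of_modelIdentification_of_theoremZ hK1 hZ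

/-- **The crux `RefinedLocusModular` with the certificate `CertH12B7` DISCHARGED modulo its two
named inputs** (NF-K1-Z model identification `hK1`; THEOREM Z finite datum `hZ`, lineages
acceefaa15e0bd61 + 0f3708606b8d5e74, certnum RQ-029): the tree's
`refinedLocusModular_of_certificates` with `hB7 := certH12B7_of_modelIdentification_of_theoremZ`.
The remaining hypotheses are the other four certificates (`hA`, `hC`, `hD`, `hE`, verbatim) and
the two bridge facts.  CONDITIONAL bookkeeping; nothing here proves modularity of a new class.
[cite: Box2022, §1.1 and Thm. 7.1] [cite: FreitasLeHungSiksek2015, Thm. 1 and §7] -/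
theorem refinedLocusModular_of_certificates_of_theoremZ
    (hK1 : ∀ (K : Type) [Field K] [NumberField K], (∃ r : K, r ^ 2 = 5) →
        ∀ E : WeierstrassCurve (NumberField.RingOfIntegers K), E.Δ ≠ 0 →
          (∃ ρ : Literature.NumberTheory.GaloisRepresentations.FramedGaloisRep K (ZMod 5) 2, (∃ e : (E.baseChange K).geomTorsion ((5 : ℕ) : ℤ) ≃+ (Fin 2 → ZMod 5), ∀ (σ : Field.absoluteGaloisGroup K) (P : (E.baseChange K).geomTorsion ((5 : ℕ) : ℤ)), e (σ • P) = ((ρ σ : GL (Fin 2) (ZMod 5)) : Matrix (Fin 2) (Fin 2) (ZMod 5)) *ᵥ (e P)) ∧ ((∀ σ : Field.absoluteGaloisGroup K, (ρ σ : GL (Fin 2) (ZMod 5)) ∈ Subgroup.closure ({(⟨!![3, 1; 3, 3], !![3, 4; 2, 3], by decide, by decide⟩ : GL (Fin 2) (ZMod 5)), (⟨!![1, 0; 0, 4], !![1, 0; 0, 4], by decide, by decide⟩ : GL (Fin 2) (ZMod 5))} : Set (GL (Fin 2) (ZMod 5)))))) →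
          (∃ ρ : Literature.NumberTheory.GaloisRepresentations.FramedGaloisRep K (ZMod 7) 2, (∃ e : (E.baseChange K).geomTorsion ((7 : ℕ) : ℤ) ≃+ (Fin 2 → ZMod 7), ∀ (σ : Field.absoluteGaloisGroup K) (P : (E.baseChange K).geomTorsion ((7 : ℕ) : ℤ)), e (σ • P) = ((ρ σ : GL (Fin 2) (ZMod 7)) : Matrix (Fin 2) (Fin 2) (ZMod 7)) *ᵥ (e P)) ∧ ((∀ σ : Field.absoluteGaloisGroup K, (((ρ σ : GL (Fin 2) (ZMod 7)) : Matrix (Fin 2) (Fin 2) (ZMod 7)) 1 0 = 0)))) →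
          ((E.baseChange K).c₄ ^ 3 = 0 * (E.baseChange K).Δ ∨
           (E.baseChange K).c₄ ^ 3 = 1728 * (E.baseChange K).Δ ∨
           (E.baseChange K).c₄ ^ 3 = 8000 * (E.baseChange K).Δ ∨
           ∃ r : K, r ^ 2 = 5 ∧ ∃ t u w : K,
            t ^ 2 + t - 1 ≠ 0 ∧ u ≠ 0 ∧
            (E.baseChange K).c₄ ^ 3 * (t ^ 2 + t - 1) ^ 5 =
              125 * (t + 1) * (2 * t + 1) ^ 3 * (2 * t ^ 2 - 3 * t + 3) ^ 3 * (E.baseChange K).Δ ∧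
            (E.baseChange K).c₄ ^ 3 * u = (u ^ 2 + 13 * u + 49) * (u ^ 2 + 5 * u + 1) ^ 3 * (E.baseChange K).Δ ∧
            w ^ 2 = (5 + 2 * r) * (8 * t ^ 2 - 12 * t + 7)))
        (hZ : ∀ (K : Type) [Field K] [NumberField K], Module.finrank ℚ K = 4 →
        ∀ r : K, r ^ 2 = 5 → ∀ t u w : K, t ^ 2 + t - 1 ≠ 0 → u ≠ 0 →
          125 * (t + 1) * (2 * t + 1) ^ 3 * (2 * t ^ 2 - 3 * t + 3) ^ 3 * u =
            (u ^ 2 + 13 * u + 49) * (u ^ 2 + 5 * u + 1) ^ 3 * (t ^ 2 + t - 1) ^ 5 →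
          w ^ 2 = (5 + 2 * r) * (8 * t ^ 2 - 12 * t + 7) →
          (u ^ 2 + 13 * u + 49) * (u ^ 2 + 5 * u + 1) ≠ 0 →
          (u ^ 2 + 13 * u + 49) * (u ^ 2 + 5 * u + 1) ^ 3 ≠ 1728 * u →
          (u = -7 ∨ u = 7 ∨ 2 * u ^ 2 + (35 + 5 * r) * u + 98 = 0 ∨ 2 * u ^ 2 + (35 - 5 * r) * u + 98 = 0))
    (hA : ∀ (K : Type) [Field K] [NumberField K], NumberField.IsTotallyReal K → Module.finrank ℚ K = 4 → (∃ r : K, r ^ 2 = 5) →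
        ∀ E : WeierstrassCurve (NumberField.RingOfIntegers K), E.Δ ≠ 0 →
          (∃ ρ : Literature.NumberTheory.GaloisRepresentations.FramedGaloisRep K (ZMod 3) 2, (∃ e : (E.baseChange K).geomTorsion ((3 : ℕ) : ℤ) ≃+ (Fin 2 → ZMod 3), ∀ (σ : Field.absoluteGaloisGroup K) (P : (E.baseChange K).geomTorsion ((3 : ℕ) : ℤ)), e (σ • P) = ((ρ σ : GL (Fin 2) (ZMod 3)) : Matrix (Fin 2) (Fin 2) (ZMod 3)) *ᵥ (e P)) ∧ ((∀ σ : Field.absoluteGaloisGroup K, (((ρ σ : GL (Fin 2) (ZMod 3)) : Matrix (Fin 2) (Fin 2) (ZMod 3)) 1 0 = 0)))) →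
          (∃ ρ : Literature.NumberTheory.GaloisRepresentations.FramedGaloisRep K (ZMod 5) 2, (∃ e : (E.baseChange K).geomTorsion ((5 : ℕ) : ℤ) ≃+ (Fin 2 → ZMod 5), ∀ (σ : Field.absoluteGaloisGroup K) (P : (E.baseChange K).geomTorsion ((5 : ℕ) : ℤ)), e (σ • P) = ((ρ σ : GL (Fin 2) (ZMod 5)) : Matrix (Fin 2) (Fin 2) (ZMod 5)) *ᵥ (e P)) ∧ ((∀ σ : Field.absoluteGaloisGroup K, (ρ σ : GL (Fin 2) (ZMod 5)) ∈ Subgroup.closure ({(⟨!![2, 0; 0, 3], !![3, 0; 0, 2], by decide, by decide⟩ : GL (Fin 2) (ZMod 5)), (⟨!![0, 1; 1, 0], !![0, 1; 1, 0], by decide, by decide⟩ : GL (Fin 2) (ZMod 5))} : Set (GL (Fin 2) (ZMod 5)))))) →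
          ((∃ ρ : Literature.NumberTheory.GaloisRepresentations.FramedGaloisRep K (ZMod 7) 2, (∃ e : (E.baseChange K).geomTorsion ((7 : ℕ) : ℤ) ≃+ (Fin 2 → ZMod 7), ∀ (σ : Field.absoluteGaloisGroup K) (P : (E.baseChange K).geomTorsion ((7 : ℕ) : ℤ)), e (σ • P) = ((ρ σ : GL (Fin 2) (ZMod 7)) : Matrix (Fin 2) (Fin 2) (ZMod 7)) *ᵥ (e P)) ∧ ((∀ σ : Field.absoluteGaloisGroup K, (((ρ σ : GL (Fin 2) (ZMod 7)) : Matrix (Fin 2) (Fin 2) (ZMod 7)) 1 0 = 0)))) ∨ (∃ ρ : Literature.NumberTheory.GaloisRepresentations.FramedGaloisRep K (ZMod 7) 2, (∃ e : (E.baseChange K).geomTorsion ((7 : ℕ) : ℤ) ≃+ (Fin 2 → ZMod 7), ∀ (σ : Field.absoluteGaloisGroup K) (P : (E.baseChange K).geomTorsion ((7 : ℕ) : ℤ)), e (σ • P) = ((ρ σ : GL (Fin 2) (ZMod 7)) : Matrix (Fin 2) (Fin 2) (ZMod 7)) *ᵥ (e P)) ∧ ((∀ σ : Field.absoluteGaloisGroup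 K, (ρ σ : GL (Fin 2) (ZMod 7)) ∈ Subgroup.closure ({(⟨!![0, 5; 3, 0], !![0, 5; 3, 0], by decide, by decide⟩ : GL (Fin 2) (ZMod 7)), (⟨!![5, 0; 3, 2], !![3, 0; 6, 4], by decide, by decide⟩ : GL (Fin 2) (ZMod 7))} : Set (GL (Fin 2) (ZMod 7))))))) →
          ((E.baseChange K).HasCM ∨ (∃ r : K, r ^ 2 = 5 ∧ ∃ a b : ℚ, (E.baseChange K).c₄ ^ 3 = ((a : K) + (b : K) * r) * (E.baseChange K).Δ)))
    (hC : ∀ (K : Type) [Field K] [NumberField K], NumberField.IsTotallyReal K → Module.finrank ℚ K = 4 → (∃ r : K, r ^ 2 = 5) →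
        ∀ E : WeierstrassCurve (NumberField.RingOfIntegers K), E.Δ ≠ 0 →
          (∃ ρ : Literature.NumberTheory.GaloisRepresentations.FramedGaloisRep K (ZMod 3) 2, (∃ e : (E.baseChange K).geomTorsion ((3 : ℕ) : ℤ) ≃+ (Fin 2 → ZMod 3), ∀ (σ : Field.absoluteGaloisGroup K) (P : (E.baseChange K).geomTorsion ((3 : ℕ) : ℤ)), e (σ • P) = ((ρ σ : GL (Fin 2) (ZMod 3)) : Matrix (Fin 2) (Fin 2) (ZMod 3)) *ᵥ (e P)) ∧ ((∀ σ : Field.absoluteGaloisGroup K, (ρ σ : GL (Fin 2) (ZMod 3)) ∈ Subgroup.closure ({(⟨!![1, 0; 0, 2], !![1, 0; 0, 2], by decide, by decide⟩ : GL (Fin 2) (ZMod 3)), (⟨!![0, 1; 1, 0], !![0, 1; 1, 0], by decide, by decide⟩ : GL (Fin 2) (ZMod 3))} : Set (GL (Fin 2) (ZMod 3)))))) →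
          (∃ ρ : Literature.NumberTheory.GaloisRepresentations.FramedGaloisRep K (ZMod 5) 2, (∃ e : (E.baseChange K).geomTorsion ((5 : ℕ) : ℤ) ≃+ (Fin 2 → ZMod 5), ∀ (σ : Field.absoluteGaloisGroup K) (P : (E.baseChange K).geomTorsion ((5 : ℕ) : ℤ)), e (σ • P) = ((ρ σ : GL (Fin 2) (ZMod 5)) : Matrix (Fin 2) (Fin 2) (ZMod 5)) *ᵥ (e P)) ∧ ((∀ σ : Field.absoluteGaloisGroup K, (ρ σ : GL (Fin 2) (ZMod 5)) ∈ Subgroup.closure ({(⟨!![2, 0; 0, 3], !![3, 0; 0, 2], by decide, by decide⟩ : GL (Fin 2) (ZMod 5)), (⟨!![0, 1; 1, 0], !![0, 1; 1, 0], by decide, by decide⟩ : GL (Fin 2) (ZMod 5))} : Set (GL (Fin 2) (ZMod 5)))))) →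
          ((E.baseChange K).HasCM ∨ (∃ r : K, r ^ 2 = 5 ∧ ∃ a b : ℚ, (E.baseChange K).c₄ ^ 3 = ((a : K) + (b : K) * r) * (E.baseChange K).Δ)))
    (hD : ∀ (K : Type) [Field K] [NumberField K], NumberField.IsTotallyReal K → Module.finrank ℚ K = 4 → (∃ r : K, r ^ 2 = 5) →
        ∀ E : WeierstrassCurve (NumberField.RingOfIntegers K), E.Δ ≠ 0 →
          (∃ ρ : Literature.NumberTheory.GaloisRepresentations.FramedGaloisRep K (ZMod 3) 2, (∃ e : (E.baseChange K).geomTorsion ((3 : ℕ) : ℤ) ≃+ (Fin 2 → ZMod 3), ∀ (σ : Field.absoluteGaloisGroup K) (P : (E.baseChange K).geomTorsion ((3 : ℕ) : ℤ)), e (σ • P) = ((ρ σ : GL (Fin 2) (ZMod 3)) : Matrix (Fin 2) (Fin 2) (ZMod 3)) *ᵥ (e P)) ∧ ((∀ σ : Field.absoluteGaloisGroup K, (ρ σ : GL (Fin 2) (ZMod 3)) ∈ Subgroup.closure ({(⟨!![1, 0; 0, 2], !![1, 0; 0, 2], by decide, by decide⟩ : GL (Fin 2) (ZMod 3)), (⟨!![0,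 1; 1, 0], !![0, 1; 1, 0], by decide, by decide⟩ : GL (Fin 2) (ZMod 3))} : Set (GL (Fin 2) (ZMod 3)))))) →
          (∃ ρ : Literature.NumberTheory.GaloisRepresentations.FramedGaloisRep K (ZMod 5) 2, (∃ e : (E.baseChange K).geomTorsion ((5 : ℕ) : ℤ) ≃+ (Fin 2 → ZMod 5), ∀ (σ : Field.absoluteGaloisGroup K) (P : (E.baseChange K).geomTorsion ((5 : ℕ) : ℤ)), e (σ • P) = ((ρ σ : GL (Fin 2) (ZMod 5)) : Matrix (Fin 2) (Fin 2) (ZMod 5)) *ᵥ (e P)) ∧ ((∀ σ : Field.absoluteGaloisGroup K, (ρ σ : GL (Fin 2) (ZMod 5)) ∈ Subgroup.closure ({(⟨!![3, 1; 3, 3], !![3, 4; 2, 3], by decide, by decide⟩ : GL (Fin 2) (ZMod 5)), (⟨!![1, 0; 0, 4], !![1, 0; 0, 4], by decide, by decide⟩ : GL (Fin 2) (ZMod 5))} : Set (GL (Fin 2) (ZMod 5)))))) →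
          ((E.baseChange K).HasCM ∨ (∃ r : K, r ^ 2 = 5 ∧ ∃ a b : ℚ, (E.baseChange K).c₄ ^ 3 = ((a : K) + (b : K) * r) * (E.baseChange K).Δ)))
    (hE : ∀ (K : Type) [Field K] [NumberField K], NumberField.IsTotallyReal K → Module.finrank ℚ K = 4 → (∃ r : K, r ^ 2 = 5) →
        ∀ E : WeierstrassCurve (NumberField.RingOfIntegers K), E.Δ ≠ 0 →
          (∃ ρ : Literature.NumberTheory.GaloisRepresentations.FramedGaloisRep K (ZMod 3) 2, (∃ e : (E.baseChange K).geomTorsion ((3 : ℕ) : ℤ) ≃+ (Fin 2 → ZMod 3), ∀ (σ : Field.absoluteGaloisGroup K) (P : (E.baseChange K).geomTorsion ((3 : ℕ) : ℤ)), e (σ • P) = ((ρ σ : GL (Fin 2) (ZMod 3)) : Matrix (Fin 2) (Fin 2) (ZMod 3)) *ᵥ (e P)) ∧ ((∀ σ : Field.absoluteGaloisGroup K, (((ρ σ : GL (Fin 2) (ZMod 3)) : Matrix (Fin 2) (Fin 2) (ZMod 3)) 1 0 = 0)))) →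
          (∃ ρ : Literature.NumberTheory.GaloisRepresentations.FramedGaloisRep K (ZMod 7) 2, (∃ e : (E.baseChange K).geomTorsion ((7 : ℕ) : ℤ) ≃+ (Fin 2 → ZMod 7), ∀ (σ : Field.absoluteGaloisGroup K) (P : (E.baseChange K).geomTorsion ((7 : ℕ) : ℤ)), e (σ • P) = ((ρ σ : GL (Fin 2) (ZMod 7)) : Matrix (Fin 2) (Fin 2) (ZMod 7)) *ᵥ (e P)) ∧ ((∀ σ : Field.absoluteGaloisGroup K, (ρ σ : GL (Fin 2) (ZMod 7)) ∈ Subgroup.closure ({(⟨!![0, 5; 3, 0], !![0, 5; 3, 0], by decide, by decide⟩ : GL (Fin 2) (ZMod 7)), (⟨!![5, 0; 3, 2], !![3, 0; 6, 4], by decide, by decide⟩ : GL (Fin 2) (ZMod 7))} : Set (GL (Fin 2) (ZMod 7)))))) →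
          ((E.baseChange K).HasCM ∨ (∃ r : K, r ^ 2 = 5 ∧ ∃ a b : ℚ, (E.baseChange K).c₄ ^ 3 = ((a : K) + (b : K) * r) * (E.baseChange K).Δ)))
    (hFLS : FLS2015_theorem1)
    (hBC : isModularEllipticCurve_baseChange_of_isSolvable_of_isAutomorphicOfWeightZero) :
    Summit.Langlands.Langlands.Theses.SqrtFiveQuarticCovers.RefinedLocusModular :=
  refinedLocusModular_of_certificates hA (certH12B7_of_modelIdentification_of_theoremZ hK1 hZ)
    hC hD hE hFLS hBC

end Summit.Langlands.Langlands.Theorems.SqrtFiveQuarticCovers
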